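import Summits.HodgeConjecture.HodgeConjecture.Theorems.MilnorKExponentialSymbolLiftRModelTransport
import Literature.AlgebraicGeometry.HodgeTheory.HodgeFiltrationModelsReductionProofs
import HarnessLib

/-!
# Every Hodge model is a scalar multiple of integration; model transport from rational pinning

Theorems file of route `MilnorKExponential` of the Hodge summit, crux `SymbolLiftR`
(stmt-HodgeConjecture-18702), line `lefschetz-fold`, kernel `stub_primitiveLiftExists`.

Completes the reduction of the disprover's `ModelTransport` (Disproof v4 §7.6: the exact surplus of
the kernel S5∃ over the crux) to a statement about ONE scalar per model:

* `HodgeModel.exists_deRham_eq_smul_integration` — **the de Rham comparison of every Hodge model of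
  a smooth projective variety is, in each degree, a non-zero scalar multiple of the (complexified)
  integration comparison** (`NaturalDeRhamComparisonRigidity_holds` for the two natural families
  `A.deRham`, `∫ ⊗ ℂ` over `A.model`-manifolds and the identity of `A.carrier`);
* `HodgeModel.HasSymbolCocycle.transport_of_rationalPinning`, `IsSymbolClass.hasSymbolCocycle_of_rationalPinning`
  — **`ModelTransport` follows from RATIONAL PINNING**: if on every symbol-normalised model of `X`
  that scalar (degree `2q + 2`) is a non-zero rational multiple of `(2πi)^{-(q+1)}`, then a symbol
  cocycle on any symbol-normalised model (in particular a symbol class, `IsSymbolClass`) gives one on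
  every integration-scaled model (`transport_of_pinned`).

Rational pinning is what the normalisation clause is for: `A'.deRham [θ₀] = A'^* c₀` with `c₀`
rational non-zero and `θ₀` a transgression of the `dlog`-power cocycle of a holomorphic line
bundle, whose integration class is `(2πi)^{q+1} c₁(L)^{q+1}` — RATIONAL (Chern rationality of an
arbitrary line cocycle, the one ingredient the tree still lacks; cf. `CechCocycleIntegral` for the
converse direction).

References: R. Thom (1954) via `NaturalDeRhamComparisonRigidity`; C. Voisin, *Hodge Theory I*
(2002), Thm. 7.10, §7.3.2.
-/

noncomputable section

-- The mandated namespace repeats `HodgeConjecture` (single-conjunct summit).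
set_option linter.dupNamespace false

open scoped Manifold Topology ContDiff
open Set Function Filter

namespace Summit.HodgeConjecture.HodgeConjecture.Theorems.SymbolLiftR

open Literature.Geometry.Kaehler Literature.NumberTheory.Transcendental
open Literature.AlgebraicGeometry Literature.AlgebraicGeometry.HodgeTheory
open Literature.AlgebraicTopology.SingularHomology (singularCohomology)
open CategoryTheory

variable {n : ℕ} {X : Motives.SchemeOver ℂ}

/-- **Every Hodge model is a scalar multiple of integration.** For a Hodge model `A` of a smooth
projective `X` and each degree `k` there is `s ≠ 0` with `A.deRham = s • (∫ ⊗ ℂ)` on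
`H^k_dR(X^an; ℂ)`: both `A.deRham` and the complexified integration family are NATURAL complex de
Rham comparison families over the manifolds charted on `A.model`
(`A.deRham_isNatural`, `DeRhamIsoFamily.complexify_isNatural integrationDeRhamIsoFamily_isNatural`),
so on the compact manifold `X^an` they differ by a scalar (`NaturalDeRhamComparisonRigidity_holds`,
with the identity diffeomorphism); the scalar is non-zero unless `H^k_dR = 0`, where `1` works.
[cite: VoisinHodgeI2002, Thm. 7.10] -/
theorem _root_.Literature.AlgebraicGeometry.HodgeTheory.HodgeModel.exists_deRham_eq_smul_integration
    (hX : Motives.IsSmoothProjective n X) (A : HodgeModel n X) (k : ℕ) :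
    ∃ s : ℂ, s ≠ 0 ∧ ∀ y : complexDeRhamCohomology A.model A.carrier k,
      A.deRham A.carrier k y = s • (integrationDeRhamIsoFamily A.model).complexify A.carrier k y := by
  haveI : CompactSpace A.carrier := by
    haveI := compactSpace_complexPoints_of_isSmoothProjective hX
    exact A.isAnalytification.homeomorph.symm.compactSpace
  obtain ⟨r, hr⟩ := NaturalDeRhamComparisonRigidity_holds A.model A.model
    (integrationDeRhamIsoFamily A.model).complexify
    (DeRhamIsoFamily.complexify_isNatural integrationDeRhamIsoFamily_isNatural)
    A.deRham A.deRham_isNatural A.carrier A.carrier (Homeomorph.refl A.carrier) contMDiff_id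
    contMDiff_id k
  have hr' : ∀ y : complexDeRhamCohomology A.model A.carrier k,
      A.deRham A.carrier k y = r • (integrationDeRhamIsoFamily A.model).complexify A.carrier k y := by
    intro y
    have h := hr y
    have hid : (⟨Homeomorph.refl A.carrier, (Homeomorph.refl A.carrier).continuous⟩ :
        C(A.carrier, A.carrier)) = ContinuousMap.id A.carrier := rfl
    rw [hid, singularCohomology.map_id] at h
    change A.deRham A.carrier k y =
      r • (integrationDeRhamIsoFamily A.model).complexify A.carrier k
        (complexDeRhamCohomology.map A.model contMDiff_id k y) at h
    rwa [complexDeRhamCohomology.map_id, LinearMap.id_apply] at h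
  by_cases hr0 : r = 0
  · -- degenerate case: `A.deRham = 0` on `Hᵏ_dR`, an isomorphism, so `Hᵏ_dR(X^an; ℂ) = 0`
    refine ⟨1, one_ne_zero, fun y ↦ ?_⟩
    have hy : y = 0 :=
      (A.deRham A.carrier k).injective (by rw [hr', hr', hr0, zero_smul, zero_smul])
    rw [hy, map_zero, map_zero, smul_zero]
  · exact ⟨r, hr0, hr'⟩

/-- **Model transport from RATIONAL PINNING.** Suppose every symbol-normalised Hodge model `A'` of
the smooth projective `X` in weight `q + 1` is rationally pinned: its comparison in degree `2q + 2`
is `r (2πi)^{-(q+1)} • (∫ ⊗ ℂ)` with `r ∈ ℚˣ`. Then a weight-`(q+1)` symbol cocycle on a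
symbol-normalised model gives one on every integration-scaled model (`transport_of_pinned`). This is
the disprover's `ModelTransport` (Disproof v4 §7.6) reduced to rational pinning.
[cite: VoisinHodgeI2002, §7.3.2] -/
theorem _root_.Literature.AlgebraicGeometry.HodgeTheory.HodgeModel.HasSymbolCocycle.transport_of_rationalPinning
    (hX : Motives.IsSmoothProjective n X) {q : ℕ}
    (hpin : ∀ A' : HodgeModel n X, A'.IsSymbolNormalized q → ∃ r : ℚ, r ≠ 0 ∧
      ∀ y : complexDeRhamCohomology A'.model A'.carrier (2 * q + 1 + 1),
        A'.deRham A'.carrier (2 * q + 1 + 1) y =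
          ((r : ℂ) * ((2 * (Real.pi : ℂ) * Complex.I) ^ (q + 1))⁻¹) •
            (integrationDeRhamIsoFamily A'.model).complexify A'.carrier (2 * q + 1 + 1) y)
    (A' B : HodgeModel n X) (hN : A'.IsSymbolNormalized q)
    (hB : ∀ (k : ℕ) (y : complexDeRhamCohomology B.model B.carrier k),
      B.deRham B.carrier k y = ((2 * (Real.pi : ℂ) * Complex.I) ^ (k / 2))⁻¹ •
        (integrationDeRhamIsoFamily B.model).complexify B.carrier k y)
    {c : complexBetti X (2 * (q + 1))} (h : A'.HasSymbolCocycle q c) : B.HasSymbolCocycle q c := by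
  obtain ⟨r, hr, hA'⟩ := hpin A' hN
  exact h.transport_of_pinned hX A' B hr hA' hB

/-- **Symbol classes live on every integration-scaled model, given rational pinning**: under the
same pinning hypothesis, `IsSymbolClass n X q c → B.HasSymbolCocycle q c` for every
integration-scaled model `B` (the guard `Nontrivial H^{2(q+1)}` of `IsSymbolClass`: in the trivial
case `c = 0` and the zero cocycle serves, `HodgeModel.hasSymbolCocycle_zero`). Hence, under rational
pinning, the crux `SymbolLiftR` (symbol classes) implies the kernel S5∃ stated on one
integration-scaled model. [cite: VoisinHodgeI2002, §7.3.2] -/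
theorem _root_.Literature.AlgebraicGeometry.HodgeTheory.IsSymbolClass.hasSymbolCocycle_of_rationalPinning
    (hX : Motives.IsSmoothProjective n X) {q : ℕ}
    (hpin : ∀ A' : HodgeModel n X, A'.IsSymbolNormalized q → ∃ r : ℚ, r ≠ 0 ∧
      ∀ y : complexDeRhamCohomology A'.model A'.carrier (2 * q + 1 + 1),
        A'.deRham A'.carrier (2 * q + 1 + 1) y =
          ((r : ℂ) * ((2 * (Real.pi : ℂ) * Complex.I) ^ (q + 1))⁻¹) •
            (integrationDeRhamIsoFamily A'.model).complexify A'.carrier (2 * q + 1 + 1) y)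
    (B : HodgeModel n X)
    (hB : ∀ (k : ℕ) (y : complexDeRhamCohomology B.model B.carrier k),
      B.deRham B.carrier k y = ((2 * (Real.pi : ℂ) * Complex.I) ^ (k / 2))⁻¹ •
        (integrationDeRhamIsoFamily B.model).complexify B.carrier k y)
    {c : complexBetti X (2 * (q + 1))} (h : IsSymbolClass n X q c) : B.HasSymbolCocycle q c := by
  obtain ⟨A', hN, hc⟩ := h
  rcases subsingleton_or_nontrivial (complexBetti X (2 * (q + 1))) with hs | hnt
  · rw [Subsingleton.elim c 0]
    exact B.hasSymbolCocycle_zero q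
  · exact hc.transport_of_rationalPinning hX hpin A' B (hN hnt) hB

/-- STUB `stub_exists_deRham_eq_smul_integration` (helper sub-goal registered on
stmt-HodgeConjecture-18702 for the kernel `stub_primitiveLiftExists`: every Hodge model's comparison is
a non-zero scalar multiple of integration — the scalar that rational pinning, i.e. the remaining
surplus of S5∃ over the crux, is about): `HodgeModel.exists_deRham_eq_smul_integration`, stated
closed. [cite: VoisinHodgeI2002, Thm. 7.10] -/
theorem stub_exists_deRham_eq_smul_integration : ∀ {n : ℕ} {X : Literature.AlgebraicGeometry.Motives.SchemeOver ℂ}, Literature.AlgebraicGeometry.Motives.IsSmoothProjective n X → ∀ (A : Literature.AlgebraicGeometry.HodgeTheory.HodgeModel n X) (k : ℕ), ∃ s : ℂ, s ≠ 0 ∧ ∀ y : complexDeRhamCohomology A.model A.carrier k, A.deRham A.carrier k y = s • (integrationDeRhamIsoFamily A.model).complexify A.carrier k y :=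
  fun hX A k ↦ A.exists_deRham_eq_smul_integration hX k

end Summit.HodgeConjecture.HodgeConjecture.Theorems.SymbolLiftR

end
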